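import Literature.MathematicalPhysics.QuantumLattice.KomaPiFluxGaussianDomination
import Literature.MathematicalPhysics.QuantumLattice.DuhamelTwoPointProofs
import Literature.MathematicalPhysics.QuantumLattice.XYOrderInfraredProofs
import HarnessLib

/-!
# The infrared (Duhamel) bound for Koma's `π`-flux BCS model (Koma 2022, §6, (6.4) and (6.9))

T. Koma, *Nambu–Goldstone modes for superconducting lattice fermions*, arXiv:2201.13135 (2022)
[Koma2022], §6 up to (6.11). From the Gaussian domination bound of Theorem 5.3 / (5.100)
(`KomaPiFlux.partitionFn_le`, file `KomaPiFluxGaussianDomination.lean`) and the second-order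
expansion in the field [DLS1978, (44)] (tree: `Matrix.gaussianDomination_duhamel_le_holds`) one gets
the bound (6.4) on the Duhamel two-point function of the field operator, and — choosing plane waves
for the field, (6.8) — the momentum-space infrared bound (6.9).

## Contents (everything PROVED; no named facts)

* `PairHopRP.fieldOp G g h = (g/4) Σ_{x∼y} h(x,y) (Γ¹_x - Γ¹_y)` and
  `PairHopRP.fieldEnergy G g h = (g/4) Σ_{x∼y} h(x,y)²` (sums over ORDERED adjacent pairs), with the
  exact expansion `H_pair(g, t·h) = H_pair(g, 0) + t·fieldOp + ½t²·fieldEnergy`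
  (`PairHopRP.pairInteraction_field`, Koma's (6.6)–(6.7)); for an antisymmetric field
  `h(x, x+e_m) = h_m(x) = -h(x+e_m, x)` these are Koma's `(g/2) Γ¹[Σ_m ∂_m h_m]` and
  `(g/2) Σ_{x,m} h_m(x)²` (remark after (6.7)).
* **`KomaPiFlux.duhamel_fieldOp_le`** — (6.4) in Lieb's frame: for `κ ≥ 0`, `g ≥ 0`, `β > 0`, any
  `U`, `B` and any REAL field `h` on the ordered bonds,
  `Re (fieldOp, fieldOp)_{β, H(B,0)} ≤ fieldEnergy / β`, the Duhamel two-point function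
  `Matrix.duhamel` of the tree ((6.3)/(6.12): `Z⁻¹ ∫₀¹ Tr[A e^{-sβH} B e^{-(1-s)βH}] ds`). In Koma's
  notation this is `(Γ¹[Σ∂h], Γ¹[Σ∂h]) ≤ (2/βg) Σ_{m,x} h_m(x)²`, the constant that [DLS1978, (44)]
  yields for the normalisation (3.5)/(6.6) of `H_int(h)` (the printed (6.4) has `1/βg`).
* `KomaPiFlux.waveField c` — the antisymmetric bond field `h(x, y) = c(y) - c(x)` of a site function
  (Koma's `h_m(x) = c(x + e_m) - c(x)`, (6.8) with `c = e^{ip·x}/√|Λ|`; here the real waves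
  `cos(p·x)`, `sin(p·x)`), `fieldOp_waveField` (`= (g/2) Σ_x (Δc)(x) Γ¹_x`, discrete Laplacian),
  and for the plane waves of momentum `p`: `fieldOp (wave cos) = -(g E_p) · C_p`,
  `fieldOp (wave sin) = -(g E_p) · S_p` with `C_p = Σ_x cos(p·x) Γ¹_x`, `S_p = Σ_x sin(p·x) Γ¹_x`,
  `E_p = Σ_m (1 - cos p_m)` (tree `dispersion`), and `Q(cos) + Q(sin) = g |Λ| E_p`.
* **`KomaPiFlux.duhamel_modes_le`** — (6.9) in Lieb's frame, real form: for `E_p > 0`,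
  `Re (C_p, C_p) + Re (S_p, S_p) ≤ |Λ| / (β g E_p)`, i.e. `(Γ̂¹_p, Γ̂¹_{-p}) ≤ 1/(β g E_p)` for
  `Γ̂¹_p = |Λ|^{-1/2} Σ_x e^{-ip·x} Γ¹_x` ((6.10); printed (6.9): `1/(2βgE_p)`, see above).

WHAT THIS IS NOT: no sum rule / Falk–Bruch step (6.13)–(6.17), no double-commutator estimates
(6.25)–(6.33), no Appendix B, no long-range order (Thm. 2.1) — sequel.

## References

* [Koma2022] T. Koma, arXiv:2201.13135, §6 (6.1)–(6.12).
* [DLS1978] F. J. Dyson, E. H. Lieb, B. Simon, J. Stat. Phys. 18 (1978) 335, eq. (44), Thm. 4.2.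
-/

noncomputable section

namespace Literature.MathematicalPhysics.QuantumLattice

open Matrix Finset HubbardWave0 NormedSpace PairHopRP LiebCutRP PairHopCutRP
open Literature.Probability.LatticeModels
open FermionTorus.Cut
open FermionTorus (shift unshift shift_unshift unshift_shift shift_injective shift_ne_unshift
  adj_iff_shift_or_unshift shiftEquiv shiftEquiv_apply ofLex_shift toTorusSite_shift toTorusSite_unshift
  toTorusSite_injective sum_shift_add_sum_shift_swap)

/-! ### The field operator and the field energy (generic graph) -/

namespace PairHopRP

section Field

variable {Λ : Type*} [LinearOrder Λ] [Fintype Λ] (G : SimpleGraph Λ) [DecidableRel G.Adj]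

/-- **The field operator** `V_h = (g/4) Σ_{x∼y} h(x,y) (Γ¹_x - Γ¹_y)` (ordered adjacent pairs): the
coefficient of `t` in `H_pair(g, t·h)`; for an antisymmetric field Koma's `(g/2) Γ¹[Σ_m ∂_m h_m]`.
[cite: Koma2022, (6.6)–(6.7) and the remark after (6.7)] -/
def fieldOp (g : ℝ) (h : Λ → Λ → ℝ) : Matrix (Finset (Orb Λ)) (Finset (Orb Λ)) ℂ :=
  ∑ x : Λ, ∑ y : Λ, if G.Adj x y then (((g / 4) * h x y : ℝ) : ℂ) • (gammaOne x - gammaOne y) else 0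

/-- **The field energy** `Q_h = (g/4) Σ_{x∼y} h(x,y)²` (ordered adjacent pairs): twice the
coefficient of `t²` in `H_pair(g, t·h)`; for an antisymmetric field Koma's `(g/2) Σ_{m,x} h_m(x)²`.
[cite: Koma2022, (6.7)] -/
def fieldEnergy (g : ℝ) (h : Λ → Λ → ℝ) : ℝ :=
  ∑ x : Λ, ∑ y : Λ, if G.Adj x y then (g / 4) * h x y ^ 2 else 0

/-- The field operator is Hermitian. [cite: Koma2022, (6.6)] -/
theorem fieldOp_isHermitian (g : ℝ) (h : Λ → Λ → ℝ) : (fieldOp G g h).IsHermitian := by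
  rw [fieldOp, IsHermitian, conjTranspose_sum]
  refine Finset.sum_congr rfl fun x _ => ?_
  rw [conjTranspose_sum]
  refine Finset.sum_congr rfl fun y _ => ?_
  split_ifs
  · rw [conjTranspose_smul, ((gammaOne_isHermitian x).sub (gammaOne_isHermitian y)).eq,
      Complex.star_def, Complex.conj_ofReal]
  · exact conjTranspose_zero

omit [LinearOrder Λ] in
/-- The field energy is nonnegative for `g ≥ 0`. [cite: Koma2022, (6.4)] -/
theorem fieldEnergy_nonneg {g : ℝ} (hg : 0 ≤ g) (h : Λ → Λ → ℝ) : 0 ≤ fieldEnergy G g h := by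
  unfold fieldEnergy
  refine Finset.sum_nonneg fun x _ => Finset.sum_nonneg fun y _ => ?_
  split_ifs
  · positivity
  · exact le_rfl

/-- **Second-order expansion of one bond term in the field**:
`(g/8){[X + ψ]² + Y²} = (g/8){X² + Y²} + (gψ/4) X + (gψ²/8)` with `X = Γ¹_x - Γ¹_y`.
[cite: Koma2022, (6.7)] -/
theorem bondTerm_field (g ψ : ℝ) (x y : Λ) :
    bondTerm g ψ x y = bondTerm g 0 x y + (((g / 4) * ψ : ℝ) : ℂ) • (gammaOne x - gammaOne y) +
      (((g / 8) * ψ ^ 2 : ℝ) : ℂ) • (1 : Matrix (Finset (Orb Λ)) (Finset (Orb Λ)) ℂ) := by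
  simp only [bondTerm, Complex.ofReal_zero, zero_smul, add_zero, Matrix.add_mul, Matrix.mul_add,
    Matrix.smul_mul, Matrix.mul_smul, Matrix.one_mul, Matrix.mul_one, smul_smul, smul_add]
  push_cast
  module

/-- **Second-order expansion of the pair interaction in the field**:
`H_pair(g, t·h) = H_pair(g, 0) + t·V_h + ½t²·Q_h`. [cite: Koma2022, (6.6)–(6.7)] -/
theorem pairInteraction_field (g : ℝ) (h : Λ → Λ → ℝ) (t : ℝ) :
    pairInteraction G g (fun x y => t * h x y) =
      pairInteraction G g (fun _ _ => 0) + (t : ℂ) • fieldOp G g h +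
        ((t ^ 2 * fieldEnergy G g h / 2 : ℝ) : ℂ) • (1 : Matrix (Finset (Orb Λ)) (Finset (Orb Λ)) ℂ) := by
  have hpt : ∀ x y : Λ, (if G.Adj x y then bondTerm g (t * h x y) x y else 0) =
      (if G.Adj x y then bondTerm g 0 x y else 0) +
        (t : ℂ) • (if G.Adj x y then (((g / 4) * h x y : ℝ) : ℂ) • (gammaOne x - gammaOne y) else 0) +
        (((t ^ 2 * (if G.Adj x y then (g / 4) * h x y ^ 2 else 0) / 2 : ℝ) : ℂ)) •
          (1 : Matrix (Finset (Orb Λ)) (Finset (Orb Λ)) ℂ) := by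
    intro x y
    split_ifs
    · rw [bondTerm_field, smul_smul]
      congr 2
      · push_cast; ring
      · push_cast; ring
    · simp
  have hQ : ((t ^ 2 * fieldEnergy G g h / 2 : ℝ) : ℂ) =
      ∑ x : Λ, ∑ y : Λ, (((t ^ 2 * (if G.Adj x y then (g / 4) * h x y ^ 2 else 0) / 2 : ℝ) : ℂ)) := by
    rw [fieldEnergy, Finset.mul_sum, Finset.sum_div, Complex.ofReal_sum]
    refine Finset.sum_congr rfl fun x _ => ?_
    rw [Finset.mul_sum, Finset.sum_div, Complex.ofReal_sum]
  unfold pairInteraction fieldOp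
  simp only [hpt, Finset.sum_add_distrib, ← Finset.smul_sum, ← Finset.sum_smul]
  rw [hQ]

/-- The Hamiltonian at the field `t·h`: `H(t·h) = H(0) + t·V_h + ½t²·Q_h`. [cite: Koma2022, (6.6)–(6.7)] -/
theorem hamiltonian_field (T : Fin 2 → Λ → Λ → ℂ) (U g : ℝ) (h : Λ → Λ → ℝ) (t B : ℝ) :
    hamiltonian G T U g (fun x y => t * h x y) B =
      hamiltonian G T U g (fun _ _ => 0) B + (t : ℂ) • fieldOp G g h +
        ((t ^ 2 * fieldEnergy G g h / 2 : ℝ) : ℂ) • (1 : Matrix (Finset (Orb Λ)) (Finset (Orb Λ)) ℂ) := by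
  unfold hamiltonian
  rw [pairInteraction_field]
  abel

end Field

end PairHopRP

/-! ### The Duhamel bound (6.4) -/

namespace KomaPiFlux

attribute [local instance] LiebCutRP.decEqTorus

variable {d L : ℕ} [NeZero L]

/-- **Koma's infrared bound (6.4), in Lieb's frame.** On the even torus `(ℤ/Lℤ)^{d+1}`, `L ≥ 4`, for
`κ ≥ 0`, `g ≥ 0`, `β > 0`, any `U`, pairing source `B`, and any REAL field `h` on the ordered
bonds: the Duhamel two-point function of the field operator `V_h = (g/4)Σ_{x∼y} h(x,y)(Γ¹_x - Γ¹_y)`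
in the Gibbs state of `H(B, 0)` obeys `Re (V_h, V_h) ≤ Q_h / β`, `Q_h = (g/4) Σ_{x∼y} h(x,y)²`.
Proof as printed: Gaussian domination (5.100) for the fields `t·h`, `t ∈ ℝ`, and the second-order
expansion [DLS1978, (44)]. [cite: Koma2022, (6.2)–(6.7)] [cite: DLS1978, eq. (44)] -/
theorem duhamel_fieldOp_le (hL : Even L) (h4 : 4 ≤ L) {β : ℝ} (hβ : 0 < β) {κ : ℝ} (hκ : 0 ≤ κ)
    (U : ℝ) {g : ℝ} (hg : 0 ≤ g) (h : FermionTorus (d + 1) L → FermionTorus (d + 1) L → ℝ) (B : ℝ) :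
    (duhamel β (hamiltonian κ U g (fun (_ _ : FermionTorus (d + 1) L) => (0 : ℝ)) B)
        (fieldOp (G d L) g h) (fieldOp (G d L) g h)).re ≤ fieldEnergy (G d L) g h / β := by
  haveI : Nonempty (Finset (Orb (FermionTorus (d + 1) L))) := ⟨∅⟩
  refine gaussianDomination_duhamel_le_holds _ β hβ _ _
    (hamiltonian_isHermitian (G d L) (piFluxAmpl κ) (piFluxAmpl_herm κ) U g _ B)
    (fieldOp_isHermitian (G d L) g h) _ (fun t => ?_)
  have key := partitionFn_le hL h4 hβ hκ U hg (fun x y => (-t) * h x y) B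
  rw [hamiltonian, PairHopRP.hamiltonian_field, Complex.ofReal_neg, neg_smul, ← sub_eq_add_neg,
    neg_sq] at key
  exact key

/-! ### Plane-wave fields: the field operator is the mode of the Laplacian -/

section Waves

/-- The antisymmetric bond field `h(x, y) = c(y) - c(x)` of a site function `c` (Koma's
`h_m(x) = c(x + e_m) - c(x)`, (6.8)). [cite: Koma2022, (6.8)] -/
def waveField (c : FermionTorus (d + 1) L → ℝ) : FermionTorus (d + 1) L → FermionTorus (d + 1) L → ℝ :=
  fun x y => c y - c x

/-- The `Γ¹`-mode of a real site function: `Γ¹[c] = Σ_x c(x) Γ¹_x`. [cite: Koma2022, after (6.4)] -/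
def gammaOneMode (c : FermionTorus (d + 1) L → ℝ) :
    Matrix (Finset (Orb (FermionTorus (d + 1) L))) (Finset (Orb (FermionTorus (d + 1) L))) ℂ :=
  ∑ x : FermionTorus (d + 1) L, (c x : ℂ) • gammaOne x

/-- The discrete Laplacian `(Δc)(x) = Σ_μ [c(x + e_μ) + c(x - e_μ) - 2c(x)]`. [cite: Koma2022, after (6.8)] -/
def latticeLaplacian (c : FermionTorus (d + 1) L → ℝ) (x : FermionTorus (d + 1) L) : ℝ :=
  ∑ μ : Fin (d + 1), (c (shift x μ) + c (unshift x μ) - 2 * c x)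

omit [NeZero L] in
/-- The `Γ¹`-modes are Hermitian. [cite: Koma2022, (6.10)] -/
theorem gammaOneMode_isHermitian (c : FermionTorus (d + 1) L → ℝ) : (gammaOneMode c).IsHermitian := by
  rw [gammaOneMode, IsHermitian, conjTranspose_sum]
  refine Finset.sum_congr rfl fun x _ => ?_
  rw [conjTranspose_smul, (gammaOne_isHermitian x).eq, Complex.star_def, Complex.conj_ofReal]

/-- **The field operator of a wave field is the mode of its Laplacian**:
`V_{∂c} = (g/2) Σ_x (Δc)(x) Γ¹_x` (summation by parts, `L ≥ 3`).
[cite: Koma2022, the two displays after (6.7)] -/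
theorem fieldOp_waveField (h3 : 3 ≤ L) (g : ℝ) (c : FermionTorus (d + 1) L → ℝ) :
    fieldOp (G d L) g (waveField c) =
      (((g / 2) : ℝ) : ℂ) • gammaOneMode (latticeLaplacian c) := by
  unfold fieldOp waveField gammaOneMode latticeLaplacian
  rw [← sum_shift_add_sum_shift_swap h3]
  -- each bond and its reverse: `(g/2)(c(x+e_μ) - c(x)) • (Γ¹_x - Γ¹_{x+e_μ})`
  have hb : ∀ (x : FermionTorus (d + 1) L) (μ : Fin (d + 1)),
      (((g / 4) * (c (shift x μ) - c x) : ℝ) : ℂ) • (gammaOne x - gammaOne (shift x μ)) +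
        (((g / 4) * (c x - c (shift x μ)) : ℝ) : ℂ) • (gammaOne (shift x μ) - gammaOne x) =
      (((g / 2) * (c (shift x μ) - c x) : ℝ) : ℂ) • gammaOne x -
        (((g / 2) * (c (shift x μ) - c x) : ℝ) : ℂ) • gammaOne (shift x μ) := by
    intro x μ
    push_cast
    module
  simp only [hb, Finset.sum_sub_distrib]
  -- reindex the second sum by `x ↦ x - e_μ`
  have hre : ∀ μ : Fin (d + 1), ∑ x : FermionTorus (d + 1) L,
      (((g / 2) * (c (shift x μ) - c x) : ℝ) : ℂ) • gammaOne (shift x μ) =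
      ∑ x : FermionTorus (d + 1) L, (((g / 2) * (c x - c (unshift x μ)) : ℝ) : ℂ) • gammaOne x := by
    intro μ
    rw [← Equiv.sum_comp (shiftEquiv (L := L) μ)
      (fun y => (((g / 2) * (c y - c (unshift y μ)) : ℝ) : ℂ) • gammaOne y)]
    simp only [shiftEquiv_apply, unshift_shift]
  have hre' : ∑ x : FermionTorus (d + 1) L, ∑ μ : Fin (d + 1),
      (((g / 2) * (c (shift x μ) - c x) : ℝ) : ℂ) • gammaOne (shift x μ) =
      ∑ x : FermionTorus (d + 1) L, ∑ μ : Fin (d + 1),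
        (((g / 2) * (c x - c (unshift x μ)) : ℝ) : ℂ) • gammaOne x := by
    rw [Finset.sum_comm]
    conv_rhs => rw [Finset.sum_comm]
    exact Finset.sum_congr rfl fun μ _ => hre μ
  rw [hre', ← Finset.sum_sub_distrib, Finset.smul_sum]
  refine Finset.sum_congr rfl fun x _ => ?_
  rw [← Finset.sum_smul, ← Finset.sum_smul, ← sub_smul, smul_smul]
  congr 1
  rw [← Finset.sum_sub_distrib, ← Finset.sum_sub_distrib]
  push_cast
  rw [Finset.mul_sum]
  refine Finset.sum_congr rfl fun μ _ => ?_
  ring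

/-- **The field energy of a wave field**: `Q_{∂c} = (g/2) Σ_x Σ_μ (c(x+e_μ) - c(x))²` (`L ≥ 3`).
[cite: Koma2022, (6.7)–(6.8)] -/
theorem fieldEnergy_waveField (h3 : 3 ≤ L) (g : ℝ) (c : FermionTorus (d + 1) L → ℝ) :
    fieldEnergy (G d L) g (waveField c) =
      (g / 2) * ∑ x : FermionTorus (d + 1) L, ∑ μ : Fin (d + 1), (c x - c (shift x μ)) ^ 2 := by
  unfold fieldEnergy waveField
  rw [← sum_shift_add_sum_shift_swap h3, Finset.mul_sum]
  refine Finset.sum_congr rfl fun x _ => ?_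
  rw [Finset.mul_sum]
  refine Finset.sum_congr rfl fun μ _ => ?_
  ring

/-! ### The plane waves of momentum `p` -/

/-- The cosine wave `x ↦ cos(p·x)` on the fermionic torus (through `toTorusSite`). [cite: Koma2022, (6.8)] -/
def cosWave (p : TorusSite (d + 1) L) (x : FermionTorus (d + 1) L) : ℝ :=
  Real.cos (torusPhase L p (FermionTorus.toTorusSite x))

/-- The sine wave `x ↦ sin(p·x)`. [cite: Koma2022, (6.8)] -/
def sinWave (p : TorusSite (d + 1) L) (x : FermionTorus (d + 1) L) : ℝ :=
  Real.sin (torusPhase L p (FermionTorus.toTorusSite x))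

/-- `Σ_μ (a_μ + b_μ - 2c) = -Σ_μ (2c - a_μ - b_μ)` (bookkeeping). [folklore] -/
private theorem sum_add_sub_two_mul (a b : Fin (d + 1) → ℝ) (c : ℝ) :
    ∑ μ, (a μ + b μ - 2 * c) = -∑ μ, (2 * c - a μ - b μ) := by
  rw [← Finset.sum_neg_distrib]
  exact Finset.sum_congr rfl fun μ _ => by ring

/-- `Δ cos(p·) = -2E_p cos(p·)`, `E_p = Σ_μ (1 - cos p_μ)`. [cite: Koma2022, display after (6.8)] -/
theorem latticeLaplacian_cosWave (p : TorusSite (d + 1) L) (x : FermionTorus (d + 1) L) :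
    latticeLaplacian (cosWave p) x = -2 * dispersion (latticeMomentum L p) * cosWave p x := by
  have h := laplacian_cos_torusPhase L p (FermionTorus.toTorusSite x)
  unfold latticeLaplacian cosWave
  simp only [toTorusSite_shift, toTorusSite_unshift]
  rw [sum_add_sub_two_mul, h]
  ring

/-- `Δ sin(p·) = -2E_p sin(p·)`. [cite: Koma2022, display after (6.8)] -/
theorem latticeLaplacian_sinWave (p : TorusSite (d + 1) L) (x : FermionTorus (d + 1) L) :
    latticeLaplacian (sinWave p) x = -2 * dispersion (latticeMomentum L p) * sinWave p x := by
  have h := laplacian_sin_torusPhase L p (FermionTorus.toTorusSite x)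
  unfold latticeLaplacian sinWave
  simp only [toTorusSite_shift, toTorusSite_unshift]
  rw [sum_add_sub_two_mul, h]
  ring

/-- **`V_{∂cos(p·)} = -g E_p C_p`**, `C_p = Σ_x cos(p·x) Γ¹_x`. [cite: Koma2022, (6.8)–(6.10)] -/
theorem fieldOp_cosWave (h3 : 3 ≤ L) (g : ℝ) (p : TorusSite (d + 1) L) :
    fieldOp (G d L) g (waveField (cosWave p)) =
      ((-(g * dispersion (latticeMomentum L p)) : ℝ) : ℂ) • gammaOneMode (cosWave p) := by
  rw [fieldOp_waveField h3, gammaOneMode, gammaOneMode, Finset.smul_sum, Finset.smul_sum]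
  refine Finset.sum_congr rfl fun x _ => ?_
  rw [latticeLaplacian_cosWave, smul_smul, smul_smul, ← Complex.ofReal_mul, ← Complex.ofReal_mul]
  congr 1
  push_cast
  ring

/-- **`V_{∂sin(p·)} = -g E_p S_p`**, `S_p = Σ_x sin(p·x) Γ¹_x`. [cite: Koma2022, (6.8)–(6.10)] -/
theorem fieldOp_sinWave (h3 : 3 ≤ L) (g : ℝ) (p : TorusSite (d + 1) L) :
    fieldOp (G d L) g (waveField (sinWave p)) =
      ((-(g * dispersion (latticeMomentum L p)) : ℝ) : ℂ) • gammaOneMode (sinWave p) := by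
  rw [fieldOp_waveField h3, gammaOneMode, gammaOneMode, Finset.smul_sum, Finset.smul_sum]
  refine Finset.sum_congr rfl fun x _ => ?_
  rw [latticeLaplacian_sinWave, smul_smul, smul_smul, ← Complex.ofReal_mul, ← Complex.ofReal_mul]
  congr 1
  push_cast
  ring

/-- **`Q(∂cos(p·)) + Q(∂sin(p·)) = g E_p |Λ|`** (`|cos - cos'|² + |sin - sin'|² = 2 - 2cos p_μ`).
[cite: Koma2022, display after (6.8) ("`Σ_x Σ_m |h_m(x)|² = 2E_p`")] -/
theorem fieldEnergy_cosWave_add_sinWave (h3 : 3 ≤ L) (g : ℝ) (p : TorusSite (d + 1) L) :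
    fieldEnergy (G d L) g (waveField (cosWave p)) + fieldEnergy (G d L) g (waveField (sinWave p)) =
      g * dispersion (latticeMomentum L p) * (L : ℝ) ^ (d + 1) := by
  rw [fieldEnergy_waveField h3, fieldEnergy_waveField h3, ← mul_add]
  have key := xyFieldEnergy_cos_add_sin L p
  unfold xyFieldEnergy at key
  have hc : ∑ x : FermionTorus (d + 1) L, ∑ μ : Fin (d + 1), (cosWave p x - cosWave p (shift x μ)) ^ 2 =
      ∑ z : TorusSite (d + 1) L, ∑ i : Fin (d + 1),
        (Real.cos (torusPhase L p z) - Real.cos (torusPhase L p (z + Pi.single i 1))) ^ 2 := by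
    rw [← Equiv.sum_comp FermionTorus.equivTorusSite]
    refine Finset.sum_congr rfl fun x _ => Finset.sum_congr rfl fun μ _ => ?_
    simp only [cosWave, toTorusSite_shift]
    rfl
  have hs : ∑ x : FermionTorus (d + 1) L, ∑ μ : Fin (d + 1), (sinWave p x - sinWave p (shift x μ)) ^ 2 =
      ∑ z : TorusSite (d + 1) L, ∑ i : Fin (d + 1),
        (Real.sin (torusPhase L p z) - Real.sin (torusPhase L p (z + Pi.single i 1))) ^ 2 := by
    rw [← Equiv.sum_comp FermionTorus.equivTorusSite]
    refine Finset.sum_congr rfl fun x _ => Finset.sum_congr rfl fun μ _ => ?_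
    simp only [sinWave, toTorusSite_shift]
    rfl
  rw [hc, hs, key]
  ring

/-! ### The momentum-space bound (6.9) -/

/-- `(aA, aB) = a² (A, B)` for the Duhamel two-point function (plumbing). [cite: DLS1978, eq. (5)] -/
private theorem duhamel_smul_smul' {n : Type*} [Fintype n] [DecidableEq n] (β : ℝ)
    (H A B : Matrix n n ℂ) (a : ℂ) : duhamel β H (a • A) (a • B) = a * a * duhamel β H A B := by
  unfold duhamel
  rw [mul_left_comm, ← smul_eq_mul (a * a), ← intervalIntegral.integral_smul]
  congr 1
  refine intervalIntegral.integral_congr fun s _ => ?_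
  simp only [Matrix.smul_mul, Matrix.mul_smul, trace_smul, smul_eq_mul]
  ring

/-- **Koma's infrared bound (6.9), in Lieb's frame (real form).** On the even torus
`(ℤ/Lℤ)^{d+1}`, `L ≥ 4`, for `κ ≥ 0`, `g > 0`, `β > 0`, any `U`, `B`, and every momentum `p` with
`E_p = Σ_μ (1 - cos p_μ) > 0`: the cosine and sine `Γ¹`-modes `C_p = Σ_x cos(p·x) Γ¹_x`,
`S_p = Σ_x sin(p·x) Γ¹_x` satisfy `Re (C_p, C_p) + Re (S_p, S_p) ≤ |Λ| / (β g E_p)` in the Gibbs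
state of `H(B, 0)` — i.e. `(Γ̂¹_p, Γ̂¹_{-p}) ≤ 1/(βgE_p)` for `Γ̂¹_p = |Λ|^{-1/2} Σ_x e^{-ip·x} Γ¹_x`
(6.10) (the printed (6.9) carries `1/(2βgE_p)`, cf. the module docstring on (6.4)).
[cite: Koma2022, (6.8)–(6.10)] [cite: DLS1978, eq. (44)] -/
theorem duhamel_modes_le (hL : Even L) (h4 : 4 ≤ L) {β : ℝ} (hβ : 0 < β) {κ : ℝ} (hκ : 0 ≤ κ)
    (U : ℝ) {g : ℝ} (hg : 0 < g) (B : ℝ) {p : TorusSite (d + 1) L}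
    (hp : 0 < dispersion (latticeMomentum L p)) :
    (duhamel β (hamiltonian κ U g (fun (_ _ : FermionTorus (d + 1) L) => (0 : ℝ)) B)
        (gammaOneMode (cosWave p)) (gammaOneMode (cosWave p))).re +
      (duhamel β (hamiltonian κ U g (fun (_ _ : FermionTorus (d + 1) L) => (0 : ℝ)) B)
        (gammaOneMode (sinWave p)) (gammaOneMode (sinWave p))).re ≤
      (L : ℝ) ^ (d + 1) / (β * g * dispersion (latticeMomentum L p)) := by
  have h3 : 3 ≤ L := by omega
  set E := dispersion (latticeMomentum L p) with hE
  set H₀ := hamiltonian κ U g (fun (_ _ : FermionTorus (d + 1) L) => (0 : ℝ)) B with hH₀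
  have hc := duhamel_fieldOp_le hL h4 hβ hκ U hg.le (waveField (cosWave p)) B
  have hs := duhamel_fieldOp_le hL h4 hβ hκ U hg.le (waveField (sinWave p)) B
  rw [fieldOp_cosWave h3, duhamel_smul_smul', ← Complex.ofReal_mul, Complex.re_ofReal_mul] at hc
  rw [fieldOp_sinWave h3, duhamel_smul_smul', ← Complex.ofReal_mul, Complex.re_ofReal_mul] at hs
  have hQ := fieldEnergy_cosWave_add_sinWave h3 g p
  have hgE : 0 < g * E := mul_pos hg hp
  -- `(gE)² (Re(C,C) + Re(S,S)) ≤ g E |Λ| / β`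
  have hsum : (g * E) ^ 2 * ((duhamel β H₀ (gammaOneMode (cosWave p)) (gammaOneMode (cosWave p))).re +
      (duhamel β H₀ (gammaOneMode (sinWave p)) (gammaOneMode (sinWave p))).re) ≤
      g * E * (L : ℝ) ^ (d + 1) / β := by
    have : (-(g * E)) * (-(g * E)) = (g * E) ^ 2 := by ring
    rw [this] at hc hs
    rw [← hQ, add_div]
    linarith
  rw [le_div_iff₀ (by positivity)]
  have h2 : (g * E) ^ 2 * (((duhamel β H₀ (gammaOneMode (cosWave p)) (gammaOneMode (cosWave p))).re +
      (duhamel β H₀ (gammaOneMode (sinWave p)) (gammaOneMode (sinWave p))).re) * (β * g * E)) ≤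
      (g * E) ^ 2 * (L : ℝ) ^ (d + 1) := by
    calc (g * E) ^ 2 * (((duhamel β H₀ (gammaOneMode (cosWave p)) (gammaOneMode (cosWave p))).re +
          (duhamel β H₀ (gammaOneMode (sinWave p)) (gammaOneMode (sinWave p))).re) * (β * g * E))
        = ((g * E) ^ 2 * ((duhamel β H₀ (gammaOneMode (cosWave p)) (gammaOneMode (cosWave p))).re +
            (duhamel β H₀ (gammaOneMode (sinWave p)) (gammaOneMode (sinWave p))).re)) * (β * g * E) := by
          ring
      _ ≤ (g * E * (L : ℝ) ^ (d + 1) / β) * (β * g * E) :=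
          mul_le_mul_of_nonneg_right hsum (by positivity)
      _ = (g * E) ^ 2 * (L : ℝ) ^ (d + 1) := by field_simp
  exact le_of_mul_le_mul_left h2 (by positivity)

end Waves

end KomaPiFlux

end Literature.MathematicalPhysics.QuantumLattice

end
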